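import Literature.Topology.FourManifolds.CollarExtension
import Literature.Topology.FourManifolds.SmoothSchoenfliesFiveLeFill
import HarnessLib

/-!
# Extending prescribed end maps over a cylinder `N × [0, 1]`: the double slide

Topic `Literature/Topology/FourManifolds`; general differential topology written for the fact
seat `provefact-Literature.Topology.FourManifolds.nonempty_diffeomorph_sphere_four_of_sblf_genus_one_noLefschetz`
(torus assembly step of the classification of closed oriented surfaces of genus one,
`SurfaceLevelCylinders.lean`, `RegularLevelSplitOrientation.lean`).  Everything here is
**proved**; the file has no named facts.

## Mathematics

Let `F⁰`, `F¹` be diffeotopies of a manifold `N` (smooth paths in `Diff N` from the identity,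
`Literature.Topology.FourManifolds.Diffeotopy`, `Diffeotopy.lean`).  The **double slide**
`(x, s) ↦ (F⁰_{β(s)} (F¹_{β(1 - s)} x), s)` of the cylinder `N × [0, 1]`, with the time profile
`β = collarProfile` of `CollarExtension.lean` (`β = 1` near `0`, `β = 0` on `[1/2, 1]`), is a
self-diffeomorphism of `N × [0, 1]` (model `I₀ × 𝓡∂ 1`) which is `F⁰₁ × {0}` on the bottom and
`F¹₁ × {1}` on the top (`Diffeotopy.doubleSlide`, `doubleSlide_bot`, `doubleSlide_top`): the two
prescribed end maps, each diffeotopic to the identity, extend simultaneously over the cylinder.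
This is the cylinder `∂Q × [0, 1]` step of Hirsch, *Differential Topology* (1976), Ch. 8 §2,
proof of Thm. 2.3 ("the isotopy can be spread out over a collar"), here for a cylinder with its
two ends rather than a collar with one (the one-ended slide is `Diffeotopy.slide`,
`CollarExtension.lean`); Milnor, *Lectures on the h-cobordism theorem* (1965), §1, proof of
Thm. 1.4 and Lemma 8.2 (diffeomorphisms of `V × [0, 1]` built from isotopies of `V`).

Transferred along a diffeomorphism `T : W ≅ N × [0, 1]` this gives
(`exists_diffeomorph_apply_eq_of_diffeotopies`): for any family of pairs `(aᵢ, bᵢ)` of points of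
`W` such that `T bᵢ` is `(F⁰₁ x, 0)` when `T aᵢ = (x, 0)` and `(F¹₁ x, 1)` when `T aᵢ = (x, 1)`,
there is a self-diffeomorphism `Φ` of `W` with `Φ aᵢ = bᵢ` — the form in which a boundary
diffeomorphism of an abstract cylinder `W` is extended over `W`.

The file also provides the **end swap** of the cylinder: the flip `s ↦ 1 - s` of `[0, 1]` as a
diffeomorphism for Mathlib's manifold-with-boundary structure `𝓡∂ 1` (the tree's `SmoothFill.flipIcc`,
`SmoothSchoenfliesFiveLeFill.lean`, here packaged as the diffeomorphism `flipIccDiffeomorph`), and `cylinderEndSwap N = id × flip`.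

## References

* M. W. Hirsch, *Differential Topology*, GTM 33 (1976), Ch. 8 §1 (isotopy, diffeotopy) and §2,
  proof of Thm. 2.3. [HirschDT1976]
* J. Milnor, *Lectures on the h-cobordism theorem*, Princeton (1965), §1 Thm. 1.4, Lemma 8.2.
  [MilnorHCobordism1965]
-/

open scoped Manifold ContDiff Topology
open Function Set

noncomputable section

namespace Literature.Topology.FourManifolds

universe u

/-! ### §1 The flip `s ↦ 1 - s` of `[0, 1]` and the end swap of a cylinder -/

section Flip

open SmoothFill

/-- **The flip `s ↦ 1 - s` as a self-diffeomorphism of `[0, 1]`.** [folklore] -/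
def flipIccDiffeomorph : Set.Icc (0 : ℝ) 1 ≃ₘ⟮𝓡∂ 1, 𝓡∂ 1⟯ Set.Icc (0 : ℝ) 1 where
  toFun := flipIcc
  invFun := flipIcc
  left_inv := flipIcc_flipIcc
  right_inv := flipIcc_flipIcc
  contMDiff_toFun := contMDiff_flipIcc
  contMDiff_invFun := contMDiff_flipIcc

/-- `flipIccDiffeomorph` is `SmoothFill.flipIcc` (`t ↦ 1 - t`, `SmoothSchoenfliesFiveLeFill.lean`)
as a function. [folklore] -/
@[simp]
theorem coe_flipIccDiffeomorph : ⇑flipIccDiffeomorph = flipIcc := rfl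

variable {E₀ H₀ : Type*} [NormedAddCommGroup E₀] [NormedSpace ℝ E₀] [TopologicalSpace H₀]
  (I₀ : ModelWithCorners ℝ E₀ H₀) (N : Type*) [TopologicalSpace N] [ChartedSpace H₀ N]

/-- **The end swap `(x, s) ↦ (x, 1 - s)` of the cylinder `N × [0, 1]`**, a self-diffeomorphism
exchanging `N × {0}` and `N × {1}`. [folklore] -/
def cylinderEndSwap :
    (N × Set.Icc (0 : ℝ) 1) ≃ₘ⟮I₀.prod (𝓡∂ 1), I₀.prod (𝓡∂ 1)⟯ (N × Set.Icc (0 : ℝ) 1) :=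
  (Diffeomorph.refl I₀ N ∞).prodCongr flipIccDiffeomorph

/-- The end swap on points. [folklore] -/
@[simp]
theorem cylinderEndSwap_apply (q : N × Set.Icc (0 : ℝ) 1) :
    cylinderEndSwap I₀ N q = (q.1, flipIcc q.2) := rfl

/-- The end swap is an involution. [folklore] -/
theorem cylinderEndSwap_cylinderEndSwap (q : N × Set.Icc (0 : ℝ) 1) :
    cylinderEndSwap I₀ N (cylinderEndSwap I₀ N q) = q := by
  simp

/-- The inverse of the end swap is the end swap. [folklore] -/
@[simp]
theorem cylinderEndSwap_symm_apply (q : N × Set.Icc (0 : ℝ) 1) :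
    (cylinderEndSwap I₀ N).symm q = (q.1, flipIcc q.2) := rfl

end Flip

/-! ### §2 The double slide of a cylinder along two diffeotopies -/

section DoubleSlide

variable {E₀ H₀ : Type*} [NormedAddCommGroup E₀] [NormedSpace ℝ E₀] [TopologicalSpace H₀]
  {I₀ : ModelWithCorners ℝ E₀ H₀} {N : Type*} [TopologicalSpace N] [ChartedSpace H₀ N]

namespace Diffeotopy

/-- The double slide `(x, s) ↦ (F⁰_{β(s)} (F¹_{β(1-s)} x), s)` of the cylinder `N × [0, 1]`
along two diffeotopies `F⁰`, `F¹` of `N` (`β = collarProfile`). [folklore] -/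
def doubleSlideFun (D₀ D₁ : Diffeotopy I₀ N) (q : N × Set.Icc (0 : ℝ) 1) :
    N × Set.Icc (0 : ℝ) 1 :=
  (D₀.toFun (collarProfile q.2) (D₁.toFun (collarProfile (1 - q.2)) q.1), q.2)

/-- The inverse double slide `(y, s) ↦ ((F¹_{β(1-s)})⁻¹ ((F⁰_{β(s)})⁻¹ y), s)`. [folklore] -/
def doubleSlideInv (D₀ D₁ : Diffeotopy I₀ N) (q : N × Set.Icc (0 : ℝ) 1) :
    N × Set.Icc (0 : ℝ) 1 :=
  (D₁.invFun (collarProfile (1 - q.2)) (D₀.invFun (collarProfile q.2) q.1), q.2)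

variable (D₀ D₁ : Diffeotopy I₀ N)

/-- The double slide is level-preserving. [folklore] -/
@[simp]
theorem doubleSlideFun_snd (q : N × Set.Icc (0 : ℝ) 1) : (doubleSlideFun D₀ D₁ q).2 = q.2 := rfl

/-- `doubleSlideInv` is a left inverse of `doubleSlideFun`. [folklore] -/
theorem doubleSlideInv_doubleSlideFun (q : N × Set.Icc (0 : ℝ) 1) :
    doubleSlideInv D₀ D₁ (doubleSlideFun D₀ D₁ q) = q := by
  obtain ⟨x, s⟩ := q
  simp [doubleSlideFun, doubleSlideInv]

/-- `doubleSlideInv` is a right inverse of `doubleSlideFun`. [folklore] -/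
theorem doubleSlideFun_doubleSlideInv (q : N × Set.Icc (0 : ℝ) 1) :
    doubleSlideFun D₀ D₁ (doubleSlideInv D₀ D₁ q) = q := by
  obtain ⟨x, s⟩ := q
  simp [doubleSlideFun, doubleSlideInv]

/-- On the bottom the double slide is the time-`1` stage of `F⁰`. [folklore] -/
theorem doubleSlideFun_bot (x : N) : doubleSlideFun D₀ D₁ (x, ⊥) = (D₀.toFun 1 x, ⊥) := by
  simp only [doubleSlideFun, Prod.mk.injEq, and_true]
  rw [show ((⊥ : Set.Icc (0 : ℝ) 1) : ℝ) = 0 from rfl, sub_zero, collarProfile_zero,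
    collarProfile_of_ge (by norm_num), D₁.toFun_zero, id]

/-- On the top the double slide is the time-`1` stage of `F¹`. [folklore] -/
theorem doubleSlideFun_top (x : N) : doubleSlideFun D₀ D₁ (x, ⊤) = (D₁.toFun 1 x, ⊤) := by
  simp only [doubleSlideFun, Prod.mk.injEq, and_true]
  rw [show ((⊤ : Set.Icc (0 : ℝ) 1) : ℝ) = 1 from rfl, sub_self, collarProfile_zero,
    collarProfile_of_ge (by norm_num), D₀.toFun_zero, id]

/-- The double slide is smooth (product model with corners `I₀ × 𝓡∂ 1`). [folklore] -/
theorem contMDiff_doubleSlideFun :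
    ContMDiff (I₀.prod (𝓡∂ 1)) (I₀.prod (𝓡∂ 1)) ∞ (doubleSlideFun D₀ D₁) := by
  have hs : ContMDiff (I₀.prod (𝓡∂ 1)) 𝓘(ℝ, ℝ) ∞ fun q : N × Set.Icc (0 : ℝ) 1 => (q.2 : ℝ) :=
    contMDiff_subtype_coe_Icc.comp contMDiff_snd
  have hs' : ContMDiff (I₀.prod (𝓡∂ 1)) 𝓘(ℝ, ℝ) ∞
      fun q : N × Set.Icc (0 : ℝ) 1 => 1 - (q.2 : ℝ) :=
    (contDiff_const.sub contDiff_id).contMDiff.comp hs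
  have h1 : ContMDiff (I₀.prod (𝓡∂ 1)) (𝓘(ℝ, ℝ).prod I₀) ∞
      fun q : N × Set.Icc (0 : ℝ) 1 => (collarProfile (1 - (q.2 : ℝ)), q.1) :=
    (contDiff_collarProfile.contMDiff.comp hs').prodMk contMDiff_fst
  have h2 : ContMDiff (I₀.prod (𝓡∂ 1)) (𝓘(ℝ, ℝ).prod I₀) ∞ fun q : N × Set.Icc (0 : ℝ) 1 =>
      (collarProfile (q.2 : ℝ), D₁.toFun (collarProfile (1 - (q.2 : ℝ))) q.1) :=
    (contDiff_collarProfile.contMDiff.comp hs).prodMk (D₁.contMDiff_uncurry_toFun.comp h1)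
  exact (D₀.contMDiff_uncurry_toFun.comp h2).prodMk contMDiff_snd

/-- The inverse double slide is smooth. [folklore] -/
theorem contMDiff_doubleSlideInv :
    ContMDiff (I₀.prod (𝓡∂ 1)) (I₀.prod (𝓡∂ 1)) ∞ (doubleSlideInv D₀ D₁) := by
  have hs : ContMDiff (I₀.prod (𝓡∂ 1)) 𝓘(ℝ, ℝ) ∞ fun q : N × Set.Icc (0 : ℝ) 1 => (q.2 : ℝ) :=
    contMDiff_subtype_coe_Icc.comp contMDiff_snd
  have hs' : ContMDiff (I₀.prod (𝓡∂ 1)) 𝓘(ℝ, ℝ) ∞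
      fun q : N × Set.Icc (0 : ℝ) 1 => 1 - (q.2 : ℝ) :=
    (contDiff_const.sub contDiff_id).contMDiff.comp hs
  have h1 : ContMDiff (I₀.prod (𝓡∂ 1)) (𝓘(ℝ, ℝ).prod I₀) ∞
      fun q : N × Set.Icc (0 : ℝ) 1 => (collarProfile (q.2 : ℝ), q.1) :=
    (contDiff_collarProfile.contMDiff.comp hs).prodMk contMDiff_fst
  have h2 : ContMDiff (I₀.prod (𝓡∂ 1)) (𝓘(ℝ, ℝ).prod I₀) ∞ fun q : N × Set.Icc (0 : ℝ) 1 =>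
      (collarProfile (1 - (q.2 : ℝ)), D₀.invFun (collarProfile (q.2 : ℝ)) q.1) :=
    (contDiff_collarProfile.contMDiff.comp hs').prodMk
      (D₀.contMDiff_uncurry_invFun.comp h1)
  exact (D₁.contMDiff_uncurry_invFun.comp h2).prodMk contMDiff_snd

/-- **The double slide of the cylinder `N × [0, 1]` along two diffeotopies `F⁰`, `F¹` of `N`**:
the self-diffeomorphism `(x, s) ↦ (F⁰_{β(s)} (F¹_{β(1-s)} x), s)`, equal to `F⁰₁ × {0}` on the
bottom and to `F¹₁ × {1}` on the top — two end maps diffeotopic to the identity extend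
simultaneously over the cylinder (Hirsch, *Differential Topology* (1976), Ch. 8 §2, proof of
Thm. 2.3, "the isotopy can be spread out over a collar"; Milnor (1965), §1, proof of Thm. 1.4).
[cite: HirschDT1976, Ch. 8 §2, proof of Thm. 2.3] -/
def doubleSlide :
    (N × Set.Icc (0 : ℝ) 1) ≃ₘ⟮I₀.prod (𝓡∂ 1), I₀.prod (𝓡∂ 1)⟯ (N × Set.Icc (0 : ℝ) 1) where
  toFun := doubleSlideFun D₀ D₁
  invFun := doubleSlideInv D₀ D₁
  left_inv := doubleSlideInv_doubleSlideFun D₀ D₁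
  right_inv := doubleSlideFun_doubleSlideInv D₀ D₁
  contMDiff_toFun := contMDiff_doubleSlideFun D₀ D₁
  contMDiff_invFun := contMDiff_doubleSlideInv D₀ D₁

/-- `doubleSlide` is `doubleSlideFun` as a function. [folklore] -/
@[simp]
theorem coe_doubleSlide : ⇑(doubleSlide D₀ D₁) = doubleSlideFun D₀ D₁ := rfl

/-- On the bottom the double slide is `F⁰₁`. [folklore] -/
theorem doubleSlide_bot (x : N) : doubleSlide D₀ D₁ (x, ⊥) = (D₀.toFun 1 x, ⊥) :=
  doubleSlideFun_bot D₀ D₁ x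

/-- On the top the double slide is `F¹₁`. [folklore] -/
theorem doubleSlide_top (x : N) : doubleSlide D₀ D₁ (x, ⊤) = (D₁.toFun 1 x, ⊤) :=
  doubleSlideFun_top D₀ D₁ x

/-- The double slide is level-preserving. [folklore] -/
@[simp]
theorem doubleSlide_snd (q : N × Set.Icc (0 : ℝ) 1) : (doubleSlide D₀ D₁ q).2 = q.2 := rfl

end Diffeotopy

end DoubleSlide

/-! ### §3 Transfer to an abstract cylinder `W ≅ N × [0, 1]` -/

section Transfer

open SmoothFill

variable {E₀ H₀ : Type*} [NormedAddCommGroup E₀] [NormedSpace ℝ E₀] [TopologicalSpace H₀]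
  {I₀ : ModelWithCorners ℝ E₀ H₀} {N : Type*} [TopologicalSpace N] [ChartedSpace H₀ N]
  {EW HW : Type*} [NormedAddCommGroup EW] [NormedSpace ℝ EW] [TopologicalSpace HW]
  {IW : ModelWithCorners ℝ EW HW} {W : Type*} [TopologicalSpace W] [ChartedSpace HW W]

/-- **Extending prescribed end maps over an abstract cylinder.** Let `T : W ≅ N × [0, 1]` be a
diffeomorphism and `F⁰`, `F¹` diffeotopies of `N`.  If `(aᵢ, bᵢ)` are pairs of points of `W` such
that `T bᵢ = (F⁰₁ x, 0)` whenever `T aᵢ = (x, 0)` and `T bᵢ = (F¹₁ x, 1)` whenever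
`T aᵢ = (x, 1)` (every `aᵢ` lying over an end), then some self-diffeomorphism `Φ` of `W` has
`Φ aᵢ = bᵢ` for all `i`: `Φ = T⁻¹ ∘ doubleSlide F⁰ F¹ ∘ T`.  (The form in which a
diffeomorphism of the boundary of a cylinder, given end by end by maps diffeotopic to the
identity, extends over the cylinder; Hirsch (1976), Ch. 8 §2, proof of Thm. 2.3.)
[cite: HirschDT1976, Ch. 8 §2, proof of Thm. 2.3] -/
theorem exists_diffeomorph_apply_eq_of_diffeotopies
    (T : W ≃ₘ⟮IW, I₀.prod (𝓡∂ 1)⟯ (N × Set.Icc (0 : ℝ) 1)) (D₀ D₁ : Diffeotopy I₀ N)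
    {ι : Sort*} (a b : ι → W)
    (h : ∀ i, ((T (a i)).2 = ⊥ ∧ T (b i) = (D₀.toFun 1 (T (a i)).1, ⊥)) ∨
      ((T (a i)).2 = ⊤ ∧ T (b i) = (D₁.toFun 1 (T (a i)).1, ⊤))) :
    ∃ Φ : W ≃ₘ⟮IW, IW⟯ W, ∀ i, Φ (a i) = b i := by
  refine ⟨T.trans ((Diffeotopy.doubleSlide D₀ D₁).trans T.symm), fun i => ?_⟩
  rw [Diffeomorph.coe_trans, Diffeomorph.coe_trans, comp_apply, comp_apply]
  have key : Diffeotopy.doubleSlide D₀ D₁ (T (a i)) = T (b i) := by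
    rcases h i with ⟨h2, hb⟩ | ⟨h2, hb⟩
    · have ha : T (a i) = ((T (a i)).1, ⊥) := Prod.ext rfl h2
      rw [ha, Diffeotopy.doubleSlide_bot, hb]
    · have ha : T (a i) = ((T (a i)).1, ⊤) := Prod.ext rfl h2
      rw [ha, Diffeotopy.doubleSlide_top, hb]
  rw [key, Diffeomorph.symm_apply_apply]

/-- **End swap of an abstract cylinder.** For `T : W ≅ N × [0, 1]`, the conjugate
`T⁻¹ ∘ (id × flip) ∘ T` is a self-diffeomorphism `X` of `W` with `T (X w) = ((T w).1, 1 - (T w).2)`;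
it exchanges the two ends `T⁻¹ (N × {0})`, `T⁻¹ (N × {1})`. [folklore] -/
theorem exists_diffeomorph_endSwap (T : W ≃ₘ⟮IW, I₀.prod (𝓡∂ 1)⟯ (N × Set.Icc (0 : ℝ) 1)) :
    ∃ X : W ≃ₘ⟮IW, IW⟯ W, ∀ w, T (X w) = ((T w).1, flipIcc (T w).2) := by
  refine ⟨T.trans ((cylinderEndSwap I₀ N).trans T.symm), fun w => ?_⟩
  rw [Diffeomorph.coe_trans, Diffeomorph.coe_trans, comp_apply, comp_apply,
    Diffeomorph.apply_symm_apply, cylinderEndSwap_apply]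

end Transfer

end Literature.Topology.FourManifolds
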